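import Mathlib
import Summits.KontsevichZagierPeriods.Zeta5Search.ScaledSeries

/-!
# BrickPhiCoeff — THEOREM 2 (ii) coefficientwise for the Taylor coefficients `φ_m` of `Φ_{n,p}` at a digit point:
`φ_0 ≡ 1 (mod p³)`, `φ_m ∈ p³ℤ_(p)` (`m ≥ 1`) — input (A2) of zi-p2's THEOREMS 5/6/7 (cell zeta5-irr)

HONEST FRAMING: systematic search; no irrationality claim unless certified. INSTRUMENT lemma of the ζ(5)
census cell zeta5-irr (HOME `run/shared/lean/pub/zeta5-irr/`; memo `zi-p2/probes/B8/thm6/THEOREM6.md` Step A: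
«(A2) `Φ_{n,p}(−j+T) = Σ_{m≥0}φ_mT^m` with `φ_0 = Φ(−j) ≡ 1 (mod p³)` and `φ_m ∈ p³ℤ_(p)` for every `m ≥ 1`
(THEOREM 2 (ii): complete residue blocks, Wolstenholme)»). Nothing here is about ζ(5); no irrationality content;
filing moves no rung. Filed by the engine seat zi-eng (g8); sequel of `BrickPhiTaylor` (zi-eng g7:
`C(p³) ∣ N − D` in `ℤ[T]`, `N/D = Φ_{n,p}(−K+T)`), `BrickLaurent` (`phiSeries`, `phiCoeff`) and `ScaledSeries`.

## The statement

For a prime `p ≥ 5`, `2B ≤ A`, every `n` and every `K ∈ ℤ`: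
**`phiSeries A B p n K = 1 + p³·G` with `G ∈ ℤ_(p)⟦T⟧`** (`phiSeries_eq_one_add`: `G` is `(0,0)`-integral), hence
`v_p(φ_0 − 1) ≥ 3` (`padicValuation_phiCoeff_zero_sub_one_le`) and `v_p(φ_m) ≥ 3` for `m ≥ 1`
(`padicValuation_phiCoeff_le`); also `φ_m ∈ ℤ_(p)` for all `m` (`isSlopeInt_phiSeries`).
Tools (generic, `ScaledSeries.IsSlopeInt`): an integer polynomial is `(0,0)`-integral (`isSlopeInt_coe_map_int`);
**the inverse of a `(w,0)`-integral series with `p`-unit constant term is `(w,0)`-integral** (`isSlopeInt_inv`, from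
the recursion `[T^k]f⁻¹ = −f(0)⁻¹Σ_{i+j=k, j<k}[T^i]f·[T^j]f⁻¹`).
-/

namespace Summit.KontsevichZagierPeriods.Zeta5Search.BrickPhiCoeff

open Finset Nat Polynomial WithZero
open Summit.KontsevichZagierPeriods.Zeta5Search.BrickPhiTaylor (phiNum phiDen not_dvd_phiDen_coeff_zero
  C_pow_three_dvd_phiNum_sub_phiDen)
open Summit.KontsevichZagierPeriods.Zeta5Search.BrickLaurent (expandAt phiSeries phiCoeff)
open Summit.KontsevichZagierPeriods.Zeta5Search.ScaledSeries (IsSlopeInt isSlopeInt_mul isSlopeInt_C)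

noncomputable section

variable {p : ℕ} [Fact p.Prime]

/-! ## Two generic tools -/

/-- An integer polynomial has `p`-integral coefficients: `(0,0)`-integral. -/
theorem isSlopeInt_coe_map_int (P : ℤ[X]) :
    IsSlopeInt p 0 0 (((P.map (Int.castRingHom ℚ)) : ℚ[X]) : PowerSeries ℚ) := by
  intro k
  rw [Polynomial.coeff_coe, Polynomial.coeff_map, eq_intCast, zero_mul, zero_add, exp_zero, Rat.padicValuation_cast]
  exact Int.padicValuation_le_one p _

/-- **Inverse of a unit series**: if `f` is `(w,0)`-integral and `f(0)` is a `p`-adic unit, then `f⁻¹` is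
`(w,0)`-integral. -/
theorem isSlopeInt_inv {w : ℤ} {f : PowerSeries ℚ} (hf : IsSlopeInt p w 0 f)
    (h0 : Rat.padicValuation p (PowerSeries.constantCoeff f) = 1) : IsSlopeInt p w 0 f⁻¹ := by
  intro k
  induction k using Nat.strong_induction_on with
  | _ k ih =>
    rw [PowerSeries.coeff_inv]
    split_ifs with hk
    · subst hk; rw [map_inv₀, h0, inv_one, Nat.cast_zero, mul_zero, add_zero, exp_zero]
    · rw [map_mul, Valuation.map_neg, map_inv₀, h0, inv_one, one_mul]
      refine Valuation.map_sum_le _ fun x hx => ?_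
      split_ifs with hx2
      · rw [map_mul]
        have hk' := mem_antidiagonal.1 hx
        calc Rat.padicValuation p (PowerSeries.coeff x.1 f) * Rat.padicValuation p (PowerSeries.coeff x.2 f⁻¹)
            ≤ exp (w * x.1 + 0) * exp (w * x.2 + 0) := mul_le_mul' (hf x.1) (ih x.2 hx2)
          _ = exp (w * k + 0) := by rw [← exp_add, ← hk']; congr 1; push_cast; ring
      · rw [map_zero]; exact _root_.zero_le

/-! ## `φ` coefficientwise -/

section phi

variable (hp3 : 3 < p) {A B : ℕ} (hAB : 2 * B ≤ A) (n : ℕ) (K : ℤ)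
include hp3

/-- `D(0)` is a `p`-adic unit. -/
theorem padicValuation_constantCoeff_phiDen (A n : ℕ) (K : ℤ) :
    Rat.padicValuation p (PowerSeries.constantCoeff
      ((((phiDen A p n K).map (Int.castRingHom ℚ)) : ℚ[X]) : PowerSeries ℚ)) = 1 := by
  rw [Polynomial.constantCoeff_coe, Polynomial.coeff_map, eq_intCast, Rat.padicValuation_cast,
    Int.padicValuation_eq_one_iff]
  exact not_dvd_phiDen_coeff_zero Fact.out hp3 A n K

/-- `1/D(T) ∈ ℤ_(p)⟦T⟧`. -/
theorem isSlopeInt_phiDen_inv (A n : ℕ) (K : ℤ) :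
    IsSlopeInt p 0 0 ((((phiDen A p n K).map (Int.castRingHom ℚ)) : ℚ[X]) : PowerSeries ℚ)⁻¹ :=
  isSlopeInt_inv (isSlopeInt_coe_map_int _) (padicValuation_constantCoeff_phiDen hp3 A n K)

/-- **`φ_m ∈ ℤ_(p)` for every `m`**: the Taylor coefficients of `Φ_{n,p} = N/D` at `−K` are `p`-integral
(`N ∈ ℤ[T]`, `1/D ∈ ℤ_(p)⟦T⟧`). -/
theorem isSlopeInt_phiSeries (A B n : ℕ) (K : ℤ) : IsSlopeInt p 0 0 (phiSeries A B p n K) := by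
  have h := isSlopeInt_mul (isSlopeInt_coe_map_int (p := p) (phiNum A B p n K)) (isSlopeInt_phiDen_inv hp3 A n K)
  rw [add_zero] at h
  rw [phiSeries, expandAt, taylor_zero, taylor_zero]
  exact h

include hAB

/-- **(A2) packaged**: `Φ_{n,p}(−K+T) = 1 + p³·G(T)` with `G ∈ ℤ_(p)⟦T⟧` (`p ≥ 5`, `2B ≤ A`). -/
theorem phiSeries_eq_one_add :
    ∃ G : PowerSeries ℚ, IsSlopeInt p 0 0 G ∧ phiSeries A B p n K = 1 + PowerSeries.C ((p : ℚ) ^ 3) * G := by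
  have hp : p.Prime := Fact.out
  obtain ⟨M, hM⟩ := C_pow_three_dvd_phiNum_sub_phiDen hp hp3 hAB n K
  have hD0 := padicValuation_constantCoeff_phiDen (p := p) hp3 A n K
  have hDne : PowerSeries.constantCoeff ((((phiDen A p n K).map (Int.castRingHom ℚ)) : ℚ[X]) : PowerSeries ℚ) ≠ 0 :=
    fun h => by rw [h, map_zero] at hD0; exact zero_ne_one hD0
  have hint := isSlopeInt_mul (isSlopeInt_coe_map_int (p := p) M) (isSlopeInt_phiDen_inv hp3 A n K)
  rw [add_zero] at hint
  refine ⟨_, hint, ?_⟩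
  have hN : (phiNum A B p n K).map (Int.castRingHom ℚ) =
      (phiDen A p n K).map (Int.castRingHom ℚ) + C ((p : ℚ) ^ 3) * M.map (Int.castRingHom ℚ) := by
    rw [← sub_eq_iff_eq_add', ← Polynomial.map_sub, hM, Polynomial.map_mul, Polynomial.map_C]
    simp
  rw [phiSeries, expandAt, taylor_zero, taylor_zero, hN, Polynomial.coe_add, Polynomial.coe_mul, Polynomial.coe_C,
    add_mul, PowerSeries.mul_inv_cancel _ hDne, mul_assoc]

/-- **`v_p(φ_0 − 1) ≥ 3`** (`φ_0 = Φ_{n,p}(−K)`; THEOREM 2 (ii) at `T = 0`). -/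
theorem padicValuation_phiCoeff_zero_sub_one_le : Rat.padicValuation p (phiCoeff A B p n K 0 - 1) ≤ exp (-3) := by
  obtain ⟨G, hG, hGeq⟩ := phiSeries_eq_one_add (p := p) hp3 hAB n K
  have hG0 : Rat.padicValuation p (PowerSeries.coeff 0 G) ≤ 1 := by simpa using hG 0
  rw [phiCoeff, hGeq, map_add, PowerSeries.coeff_one, if_pos rfl, add_sub_cancel_left, PowerSeries.coeff_C_mul,
    map_mul, map_pow, Rat.padicValuation_self, ← exp_nsmul]
  calc exp (3 • (-1 : ℤ)) * Rat.padicValuation p (PowerSeries.coeff 0 G) ≤ exp (3 • (-1 : ℤ)) * 1 :=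
        mul_le_mul' le_rfl hG0
    _ = exp (-3) := by rw [mul_one, nsmul_eq_mul]; norm_num

/-- **`v_p(φ_m) ≥ 3` for `m ≥ 1`** (THEOREM 2 (ii) coefficientwise: `φ_m ∈ p³ℤ_(p)`). -/
theorem padicValuation_phiCoeff_le {m : ℕ} (hm : 1 ≤ m) : Rat.padicValuation p (phiCoeff A B p n K m) ≤ exp (-3) := by
  obtain ⟨G, hG, hGeq⟩ := phiSeries_eq_one_add (p := p) hp3 hAB n K
  have hGm : Rat.padicValuation p (PowerSeries.coeff m G) ≤ 1 := by simpa using hG m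
  rw [phiCoeff, hGeq, map_add, PowerSeries.coeff_one, if_neg (by omega), zero_add, PowerSeries.coeff_C_mul, map_mul,
    map_pow, Rat.padicValuation_self, ← exp_nsmul]
  calc exp (3 • (-1 : ℤ)) * Rat.padicValuation p (PowerSeries.coeff m G) ≤ exp (3 • (-1 : ℤ)) * 1 :=
        mul_le_mul' le_rfl hGm
    _ = exp (-3) := by rw [mul_one, nsmul_eq_mul]; norm_num

end phi

end

end Summit.KontsevichZagierPeriods.Zeta5Search.BrickPhiCoeff
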